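import Summits.Schanuel.Schanuel.Theorems.SoloInformedAPIntegrality
import Summits.Schanuel.Schanuel.Theorems.SoloInformedServedSet

/-!
# Cluster weights for Lemma AE₃ (weighted analytic core, per-triple depth, point weights)

Soloist file (informed mode, seat `solo-Schanuel-informed`, s184).  First of the files of the
seat's THEOREM AE₃♯-1 (`paper`-side: work note `work/s184/CLUSTER-note.md`), which removes the
depth dilution of the served-set lemma from THEOREM AE₃-1 (`SoloInformedTheoremAE3`): instead
of serving each point `x ξ` by ONE private root at the diluted depth
`W = (n^ν − c₁ n) / t` (`t` the Markov serving parameter), every root `ρ_i` of the CLUSTER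
`C_x = {i : ‖ρ_i − x ξ‖ < r}` is kept with its WEIGHT `u_{x,i} = log (1/‖ρ_i − x ξ‖) > 0`;
the cluster carries total weight `U_x = ∑_{C_x} u ≥ n^ν − c₁ n` (the full depth), Lemma AE₃
is applied per triple of roots at the depth `min (u_i, u_j, u_k)`, and a weighted random choice
of one representative per cluster (file `SoloInformedClusterSelection`) has few violated
progressions ON AVERAGE at the full depth.  This file holds the three elementary inputs:

* `soloCW_one_le_prod_mul_mahlerMeasure_pow`, `soloCW_sum_log_le` — the WEIGHTED form of the
  AE₃ analytic core (`SoloInformedAPIntegrality`): for any finset `T` of triples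
  `t = (i, j, k)` with `L_t = ρ_i + ρ_k − 2 ρ_j ≠ 0`,
  `∑_{t ∈ T} log (1/‖L_t‖) ≤ 3 D² · log M(F) + D³ · log 4`
  (the uniform-`ε` form `#T · log(1/ε) ≤ …` is the special case `‖L_t‖ ≤ ε`);
* `soloCW_norm_lin_le_exp`, `soloCW_min_le_log` — PER-TRIPLE DEPTH: roots within
  `e^{-u}, e^{-v}, e^{-w}` of `x ξ, y ξ, z ξ` with `x + z = 2 y` have
  `‖ρ_i + ρ_k − 2 ρ_j‖ ≤ 4 e^{-min(u,v,w)}`, i.e. `min(u,v,w) ≤ log(1/‖L‖) + log 4` if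
  `L ≠ 0`;
* `soloCW_log_inv_pos`, `soloCW_cluster_weight_ge` — POINT WEIGHTS: with `1 ≤ ‖lc Q‖`,
  `D ≤ N`, `exp(−c₁) ≤ r ≤ 1`, `‖Q(z)‖ ≤ e^{−V}` and no root equal to `z`, the roots in the
  disc of radius `r` about `z` have positive weights summing to `≥ V − c₁ N`.

What this is NOT.  Elementary bookkeeping for the seat's toy node
`RoyAdditiveDirichletExponent` ([cite: Roy2010, Thm 1.1]); nothing here bears on the summit
statement `Literature.Periods.SchanuelConjecture` (the seat's verdict, no path, is unchanged).
Classical devices, no novelty claimed.  Tree files and Mathlib only; no definitions; no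
literature hypothesis; axioms the standard three.
-/

namespace Summit.Schanuel.Schanuel.Theorems

open Finset Polynomial

section WeightedCore

variable {D : ℕ}

/-- **AE₃ analytic core, weighted multiplicative form.**  For any finset `T` of triples with
`L t ≠ 0`: `1 ≤ (∏_{t ∈ T} ‖L t‖) · 4 ^ (D³) · M(F) ^ (3 D²)`. -/
theorem soloCW_one_le_prod_mul_mahlerMeasure_pow (F : Polynomial ℤ) (hF : F ≠ 0)
    (hD : F.natDegree = D) (ρ : Fin D → ℂ)
    (hρ : univ.val.map ρ = (F.map (Int.castRingHom ℂ)).roots)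
    (L : Fin D × Fin D × Fin D → ℂ) (hL : ∀ t, L t = ρ t.1 + ρ t.2.2 - 2 * ρ t.2.1)
    (T : Finset (Fin D × Fin D × Fin D)) (hT : ∀ t ∈ T, L t ≠ 0) :
    1 ≤ (∏ t ∈ T, ‖L t‖) * 4 ^ (D ^ 3) *
      (F.map (Int.castRingHom ℂ)).mahlerMeasure ^ (3 * D ^ 2) := by
  classical
  obtain ⟨g, hg⟩ : ∃ g : Fin D → ℝ, ∀ l, g l = max 1 ‖ρ l‖ := ⟨_, fun _ => rfl⟩
  obtain ⟨J, hJ⟩ : ∃ J : Finset (Fin D × Fin D × Fin D), J = univ.filter (fun t => L t ≠ 0) :=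
    ⟨_, rfl⟩
  have h1g : ∀ l, 1 ≤ g l := fun l => by rw [hg]; exact le_max_left _ _
  have hB1 : ∀ t : Fin D × Fin D × Fin D, 1 ≤ 4 * g t.1 * g t.2.1 * g t.2.2 := by
    intro t
    have h := one_le_mul_of_one_le_of_one_le
      (one_le_mul_of_one_le_of_one_le (h1g t.1) (h1g t.2.1)) (h1g t.2.2)
    linarith
  have hTJ : T ⊆ J := fun t ht => by
    rw [hJ]; exact Finset.mem_filter.mpr ⟨Finset.mem_univ _, hT t ht⟩
  have hAE1 := soloAP_one_le_abs_pow_mul_prod_norm F hF hD ρ hρ L hL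
  rw [← hJ] at hAE1
  have hLle : ∀ t, ‖L t‖ ≤ 4 * g t.1 * g t.2.1 * g t.2.2 := by
    intro t
    rw [hL, hg, hg, hg]
    exact soloAP_norm_lin_le (ρ t.1) (ρ t.2.1) (ρ t.2.2)
  have hT0 : 0 ≤ ∏ t ∈ T, ‖L t‖ := Finset.prod_nonneg fun _ _ => norm_nonneg _
  have hstep : ∏ t ∈ J, ‖L t‖ ≤
      (∏ t ∈ T, ‖L t‖) * ∏ t : Fin D × Fin D × Fin D, (4 * g t.1 * g t.2.1 * g t.2.2) := by
    calc ∏ t ∈ J, ‖L t‖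
        = (∏ t ∈ T, ‖L t‖) * ∏ t ∈ J \ T, ‖L t‖ := by
          rw [← Finset.prod_sdiff hTJ, mul_comm]
      _ ≤ (∏ t ∈ T, ‖L t‖) * ∏ t ∈ J \ T, (4 * g t.1 * g t.2.1 * g t.2.2) :=
          mul_le_mul_of_nonneg_left
            (Finset.prod_le_prod (fun t _ => norm_nonneg _) (fun t _ => hLle t)) hT0
      _ ≤ (∏ t ∈ T, ‖L t‖) *
            ∏ t : Fin D × Fin D × Fin D, (4 * g t.1 * g t.2.1 * g t.2.2) :=
          mul_le_mul_of_nonneg_left (Finset.prod_le_prod_of_subset_of_one_le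
            (Finset.subset_univ _) (fun t _ => zero_le_one.trans (hB1 t))
            (fun t _ _ => hB1 t)) hT0
  have htriples := soloAP_prod_triples_eq (D := D) g
  have hM : (F.map (Int.castRingHom ℂ)).mahlerMeasure = |(F.leadingCoeff : ℝ)| * ∏ l, g l := by
    rw [soloAE_mahlerMeasure_map_eq F ρ hρ]
    simp only [hg]
  rw [hM]
  calc (1 : ℝ) ≤ |(F.leadingCoeff : ℝ)| ^ (3 * D ^ 2) * ∏ t ∈ J, ‖L t‖ := hAE1
    _ ≤ |(F.leadingCoeff : ℝ)| ^ (3 * D ^ 2) *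
        ((∏ t ∈ T, ‖L t‖) * (4 ^ (D ^ 3) * (∏ l, g l) ^ (3 * D ^ 2))) := by
        refine mul_le_mul_of_nonneg_left ?_ (pow_nonneg (abs_nonneg _) _)
        rw [← htriples]
        exact hstep
    _ = (∏ t ∈ T, ‖L t‖) * 4 ^ (D ^ 3) *
        (|(F.leadingCoeff : ℝ)| * ∏ l, g l) ^ (3 * D ^ 2) := by ring

/-- **AE₃ analytic core, weighted logarithmic form.**  For any finset `T` of triples with
`L t ≠ 0`: `∑_{t ∈ T} log (1/‖L t‖) ≤ 3 D² · log M(F) + D³ · log 4`. -/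
theorem soloCW_sum_log_le (F : Polynomial ℤ) (hF : F ≠ 0)
    (hD : F.natDegree = D) (ρ : Fin D → ℂ)
    (hρ : univ.val.map ρ = (F.map (Int.castRingHom ℂ)).roots)
    (L : Fin D × Fin D × Fin D → ℂ) (hL : ∀ t, L t = ρ t.1 + ρ t.2.2 - 2 * ρ t.2.1)
    (T : Finset (Fin D × Fin D × Fin D)) (hT : ∀ t ∈ T, L t ≠ 0) :
    ∑ t ∈ T, Real.log (1 / ‖L t‖) ≤
      ((3 * D ^ 2 : ℕ) : ℝ) * Real.log (F.map (Int.castRingHom ℂ)).mahlerMeasure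
        + ((D ^ 3 : ℕ) : ℝ) * Real.log 4 := by
  have h := soloCW_one_le_prod_mul_mahlerMeasure_pow F hF hD ρ hρ L hL T hT
  have hF' : F.map (Int.castRingHom ℂ) ≠ 0 :=
    (Polynomial.map_ne_zero_iff (Int.castRingHom ℂ).injective_int).mpr hF
  have hMpos : 0 < (F.map (Int.castRingHom ℂ)).mahlerMeasure :=
    Polynomial.mahlerMeasure_pos_of_ne_zero hF'
  have hLpos : ∀ t ∈ T, 0 < ‖L t‖ := fun t ht => norm_pos_iff.mpr (hT t ht)
  have hTpos : 0 < ∏ t ∈ T, ‖L t‖ := Finset.prod_pos hLpos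
  have hlog := Real.log_le_log one_pos h
  rw [Real.log_one, Real.log_mul (mul_pos hTpos (by positivity)).ne' (by positivity),
    Real.log_mul hTpos.ne' (by positivity), Real.log_pow, Real.log_pow,
    Real.log_prod (fun t ht => (hLpos t ht).ne')] at hlog
  have hsum : ∑ t ∈ T, Real.log (1 / ‖L t‖) = -∑ t ∈ T, Real.log ‖L t‖ := by
    rw [← Finset.sum_neg_distrib]
    refine Finset.sum_congr rfl (fun t _ => ?_)
    rw [one_div, Real.log_inv]
  rw [hsum]
  push_cast at hlog ⊢
  linarith

end WeightedCore

section PerTriple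

/-- **Per-triple depth.**  Roots `a, b, c` within `e^{-u}, e^{-v}, e^{-w}` of points
`x, y, z` with `x + z = 2 y` form an inexact progression of defect `≤ 4 e^{-min(u,v,w)}`. -/
theorem soloCW_norm_lin_le_exp {a b c x y z : ℂ} {u v w : ℝ} (ha : ‖a - x‖ ≤ Real.exp (-u))
    (hb : ‖b - y‖ ≤ Real.exp (-v)) (hc : ‖c - z‖ ≤ Real.exp (-w)) (hxyz : x + z = 2 * y) :
    ‖a + c - 2 * b‖ ≤ 4 * Real.exp (-min u (min v w)) := by
  have hdec : a + c - 2 * b = (a - x) + (c - z) - 2 * (b - y) := by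
    rw [show a + c - 2 * b = (a - x) + (c - z) - 2 * (b - y) + (x + z - 2 * y) by ring, hxyz,
      sub_self, add_zero]
  have hu : Real.exp (-u) ≤ Real.exp (-min u (min v w)) :=
    Real.exp_le_exp.mpr (neg_le_neg (min_le_left _ _))
  have hv : Real.exp (-v) ≤ Real.exp (-min u (min v w)) :=
    Real.exp_le_exp.mpr (neg_le_neg ((min_le_right _ _).trans (min_le_left _ _)))
  have hw : Real.exp (-w) ≤ Real.exp (-min u (min v w)) :=
    Real.exp_le_exp.mpr (neg_le_neg ((min_le_right _ _).trans (min_le_right _ _)))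
  rw [hdec]
  calc ‖(a - x) + (c - z) - 2 * (b - y)‖ ≤ ‖(a - x) + (c - z)‖ + ‖2 * (b - y)‖ := norm_sub_le _ _
    _ ≤ ‖a - x‖ + ‖c - z‖ + 2 * ‖b - y‖ := by
        rw [norm_mul, Complex.norm_two]
        linarith [norm_add_le (a - x) (c - z)]
    _ ≤ 4 * Real.exp (-min u (min v w)) := by linarith

/-- Logarithmic form of `soloCW_norm_lin_le_exp`: if moreover `a + c − 2 b ≠ 0` then
`min(u,v,w) ≤ log (1/‖a + c − 2 b‖) + log 4`. -/
theorem soloCW_min_le_log {a b c x y z : ℂ} {u v w : ℝ} (ha : ‖a - x‖ ≤ Real.exp (-u))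
    (hb : ‖b - y‖ ≤ Real.exp (-v)) (hc : ‖c - z‖ ≤ Real.exp (-w)) (hxyz : x + z = 2 * y)
    (hne : a + c - 2 * b ≠ 0) :
    min u (min v w) ≤ Real.log (1 / ‖a + c - 2 * b‖) + Real.log 4 := by
  have h := soloCW_norm_lin_le_exp ha hb hc hxyz
  have hpos : 0 < ‖a + c - 2 * b‖ := norm_pos_iff.mpr hne
  have hlog := Real.log_le_log hpos h
  rw [Real.log_mul (by norm_num) (Real.exp_pos _).ne', Real.log_exp] at hlog
  rw [one_div, Real.log_inv]
  linarith

end PerTriple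

section PointWeights

variable {D : ℕ}

/-- A root in the disc of radius `r ≤ 1` about `z`, different from `z`, has positive weight
`log (1/‖ρ i − z‖)`. -/
theorem soloCW_log_inv_pos {w z : ℂ} {r : ℝ} (hr1 : r ≤ 1) (hw : ‖w - z‖ < r) (hwz : w ≠ z) :
    0 < Real.log (1 / ‖w - z‖) := by
  have hpos : 0 < ‖w - z‖ := norm_pos_iff.mpr (sub_ne_zero.mpr hwz)
  rw [one_div, Real.log_inv, neg_pos]
  exact Real.log_neg hpos (hw.trans_le hr1)

/-- `exp (− log (1/d)) = d` for `d = ‖w − z‖ > 0`. -/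
theorem soloCW_exp_neg_log_inv {w z : ℂ} (hwz : w ≠ z) :
    Real.exp (-Real.log (1 / ‖w - z‖)) = ‖w - z‖ := by
  have hpos : 0 < ‖w - z‖ := norm_pos_iff.mpr (sub_ne_zero.mpr hwz)
  rw [one_div, Real.log_inv, neg_neg, Real.exp_log hpos]

/-- **Point weights.**  `1 ≤ ‖lc Q‖`, roots enumerated by `ρ : Fin D → ℂ`, `D ≤ N`,
`exp (−c₁) ≤ r ≤ 1`, `‖Q(z)‖ ≤ e^{−V}`, and no root equals `z`: then the weights of the roots
in the disc of radius `r` about `z` sum to at least `V − c₁ N`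
(from `e^{−V} ≥ ‖Q(z)‖ ≥ ∏_{disc} ‖z − ρ i‖ · r ^ D`). -/
theorem soloCW_cluster_weight_ge {N : ℕ} (Q : ℂ[X]) (hlc : 1 ≤ ‖Q.leadingCoeff‖)
    (ρ : Fin D → ℂ) (hρ : univ.val.map ρ = Q.roots) (hDN : D ≤ N) (z : ℂ) {r c₁ V : ℝ}
    (hr1 : r ≤ 1) (hc : Real.exp (-c₁) ≤ r) (hsmall : ‖Q.eval z‖ ≤ Real.exp (-V))
    (hz : ∀ i, ρ i ≠ z) :
    V - c₁ * N ≤ ∑ i ∈ univ.filter (fun i => ‖ρ i - z‖ < r), Real.log (1 / ‖ρ i - z‖) := by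
  have hr0 : 0 < r := (Real.exp_pos _).trans_le hc
  have hdpos : ∀ i, 0 < ‖z - ρ i‖ := fun i => norm_pos_iff.mpr (sub_ne_zero.mpr (hz i).symm)
  set A := univ.filter (fun i => ‖ρ i - z‖ < r) with hA
  have hsplit : ∏ i, ‖z - ρ i‖ =
      (∏ i ∈ A, ‖z - ρ i‖) * ∏ i ∈ univ.filter (fun i => ¬ ‖ρ i - z‖ < r), ‖z - ρ i‖ :=
    (Finset.prod_filter_mul_prod_filter_not univ _ _).symm
  have hout : Real.exp (-(c₁ * N)) ≤
      ∏ i ∈ univ.filter (fun i => ¬ ‖ρ i - z‖ < r), ‖z - ρ i‖ := by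
    calc Real.exp (-(c₁ * N)) = Real.exp (-c₁) ^ N := by
          rw [← Real.exp_nat_mul]; ring_nf
      _ ≤ r ^ N := pow_le_pow_left₀ (Real.exp_pos _).le hc N
      _ ≤ r ^ #(univ.filter (fun i => ¬ ‖ρ i - z‖ < r)) := by
          apply pow_le_pow_of_le_one hr0.le hr1
          exact (Finset.card_le_univ _).trans (by simpa using hDN)
      _ = ∏ _i ∈ univ.filter (fun i => ¬ ‖ρ i - z‖ < r), r := (Finset.prod_const _).symm
      _ ≤ ∏ i ∈ univ.filter (fun i => ¬ ‖ρ i - z‖ < r), ‖z - ρ i‖ := by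
          refine Finset.prod_le_prod (fun _ _ => hr0.le) (fun i hi => ?_)
          rw [norm_sub_rev]
          exact not_lt.mp (Finset.mem_filter.mp hi).2
  have hApos : 0 < ∏ i ∈ A, ‖z - ρ i‖ := Finset.prod_pos fun i _ => hdpos i
  have hprod_le : ∏ i, ‖z - ρ i‖ ≤ Real.exp (-V) := by
    have : ∏ i, ‖z - ρ i‖ ≤ ‖Q.eval z‖ := by
      rw [soloSS_norm_eval_eq Q ρ hρ z]
      exact le_mul_of_one_le_left (Finset.prod_nonneg fun _ _ => norm_nonneg _) hlc
    exact this.trans hsmall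
  have hkey : (∏ i ∈ A, ‖z - ρ i‖) * Real.exp (-(c₁ * N)) ≤ Real.exp (-V) :=
    ((mul_le_mul_of_nonneg_left hout hApos.le).trans (hsplit.symm.le)).trans hprod_le
  have hkey' : ∏ i ∈ A, ‖z - ρ i‖ ≤ Real.exp (-V + c₁ * N) := by
    rw [show -V + c₁ * N = -V - (-(c₁ * N)) by ring, Real.exp_sub,
      le_div_iff₀ (Real.exp_pos _)]
    exact hkey
  have hlog := Real.log_le_log hApos hkey'
  rw [Real.log_exp, Real.log_prod (fun i _ => (hdpos i).ne')] at hlog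
  have hsum : ∑ i ∈ A, Real.log (1 / ‖ρ i - z‖) = -∑ i ∈ A, Real.log ‖z - ρ i‖ := by
    rw [← Finset.sum_neg_distrib]
    refine Finset.sum_congr rfl (fun i _ => ?_)
    rw [one_div, Real.log_inv, norm_sub_rev]
  rw [hsum]
  linarith

end PointWeights

end Summit.Schanuel.Schanuel.Theorems
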